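import Summits.BirchSwinnertonDyer.BirchSwinnertonDyer.Theses.PlecticLegs
import Summits.BirchSwinnertonDyer.BirchSwinnertonDyer.Theorems.PlecticRankUB.Negative.PlecticRankUBFalseWithoutAnalyticRank
import Summits.BirchSwinnertonDyer.BirchSwinnertonDyer.Theorems.PlecticLegsPlecticRankUBStubGenericLine
import Summits.BirchSwinnertonDyer.BirchSwinnertonDyer.Theorems.PlecticLegsPlecticRankUBStubLineData
import Summits.BirchSwinnertonDyer.BirchSwinnertonDyer.Theorems.PlecticLegsPlecticRankUBStubHalfTwoMax
import Summits.BirchSwinnertonDyer.BirchSwinnertonDyer.Theorems.PlecticLegsPlecticRankUBRankFiveWitness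
import Literature.NumberTheory.EllipticCurves.IwasawaSelmer
import Literature.NumberTheory.EllipticCurves.GaloisAction
import Literature.NumberTheory.Automorphic.Sweep1
import Literature.NumberTheory.QuadraticFields.FundamentalDiscriminant
import Mathlib.Tactic.NormNum.Prime
import HarnessLib

/-!
# Line `heegner-leading-form-plectic-certificate` — skeleton for crux `PlecticRankUB`
# (stmt-BirchSwinnertonDyer-17519, route `PlecticLegs`, crux #3)

Crux (verbatim, `Theses/PlecticLegs.lean`):
`PlecticRankUB := ∀ F [NumberField F] [IsTotallyReal F] (V : WeierstrassCurve F) [V.IsElliptic],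
  2 ≤ [F:ℚ] → V.analyticRank = [F:ℚ] → V.mordellWeilRank ≤ [F:ℚ]`.

Idea card `Cruxes/PlecticRankUB/Ideas/heegner-leading-form-plectic-certificate.md` (round 2, passed
3–0 by TRIAGE-r2-1, r2-2, r2-3); line card `Lines/heegner-leading-form-plectic-certificate.md`.

## The line in one paragraph

Over a CM quadratic extension `K` of the totally real field `F` (`d = [F:ℚ]`), along an
ANTICYCLOTOMIC `ℤ_p`-LINE `κ` (a `ℤ_p`-quotient of the maximal anticyclotomic `ℤ_p^n`-tower
`Φ` of `K`, `n = d`), the Pontryagin dual `X = X(V/K_∞)` of `Sel_{p^∞}(V/K_∞)` (tree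
`WeierstrassCurve.SelmerDualData`) is a finitely generated `Λ = ℤ_p⟦T⟧`-module of generic rank
`ρ ∈ {0, 1}` (definite / indefinite sign). Two inequalities on
`e := ord_T char_Λ(X_tors)`:
* LOWER (derived `p`-adic heights, Bertolini–Darmon 1995 / Howard 2004 / Castella–Hsu–Kundu–Lee–Liu
  2023 Thm 1.5(ii), transported to `K/F`): `2·(max(r⁺, r⁻) − ρ) ≤ e`, where `r⁺ = rank V(F)` and
  `r⁻ = rank V(K) − rank V(F)` — NO PARITY STEP (`stub_twoMaxInequality`);
* UPPER (bipartite Euler system of big Heegner / theta classes along the line, Howard 2006 /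
  Bertolini–Darmon 2005 / Longo 2012 / Fornea–Gehrmann 2023 Thm 3.3 over `F`): `e ≤ 2·ν_ℓ`, where
  `ν_ℓ` is the `T`-order of the restriction to the line of ONE multivariable class
  `g ∈ Λ_n = ℤ_p⟦T₁,…,T_n⟧` (the big Heegner class / theta element in coordinates). The class is not
  nameable over the tree, so it is POSITED as the interface `BoundingClass` (a nonzero `g`, an
  exceptional hypersurface `h`, and the bound along every non-exceptional line) with the separate
  CONSTRUCTION statement `stub_boundingClass_exists` (never smuggled: D-0019 §1).
Then `GenericLine` (pure algebra, `stub_genericLine`): along a generic integral direction `a`,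
`ν_ℓ = ord_T g((1+T)^{a₁}−1, …, (1+T)^{a_n}−1)` equals the TOTAL ORDER of `g` (degree of its
LEADING FORM). The crux is therefore exactly the certificate (`stub_leadingFormCertificate`, the
line's one conjecture-sized stub, the ONLY place where `V.analyticRank = d` is consumed — cf.
`leadingFormCertificate_false_without_analyticRank` below, from the landed p146677):
"at some admissible `(K, p)` the minimal total order of a bounding class on the maximal
anticyclotomic tower is `≤ d − ρ`" (leading form of degree `d − 1` in the indefinite branch: on the
exceptional sector its mixed coefficient is Fornea's plectic Heegner class `κ_{V,𝒮}`, FG 2023 Lemma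
3.11 / Fornea 2026 Thm 2, so the open content is the `r_an`-keyed plectic non-vanishing shared with
crux 17518; `ord θ ≤ d` in the definite branch). Chain (kernel-checked in `mordellWeilRank_le_of_leadingFormCertificate` / `PlecticRankUB_of`):
`2(max(r⁺,r⁻) − ρ) ≤ e ≤ 2ν_ℓ = 2·ord g ≤ 2(d − ρ)` ⟹ `rank V(F) = r⁺ ≤ d` — `omega`, every `d`,
no parity, no descent step (ranks are Mordell–Weil ranks over `F` and `K`).

## Registered stubs (5) and composition

* `stub_twoMaxInequality` (K2; XL; theorem-shaped): the parity-free two-max inequality over `K/F`.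
* `stub_boundingClass_exists` (K3; XL; theorem-shaped, assembly over `F` unprinted): existence of a
  bounding class on the maximal anticyclotomic tower for admissible `(V, K, p)`.
* `stub_leadingFormCertificate` (K1 = CERT; conjecture-sized; HARDEST): the leading-form bound.
* `stub_lineData` (P; M–L; known, Greenberg LNM 1716 §1): lines of a tower are `ℤ_p`-extensions
  with a topological generator and a finitely generated Selmer dual datum.
* `stub_genericLine` (P2; M; pure `MvPowerSeries` algebra, provable now).
* `PlecticRankUB_of : PlecticRankUB` — the skeleton theorem: no hypotheses, the five stubs invoked
  BY NAME (every one consumed), through the sorry-free chain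
  `mordellWeilRank_le_of_leadingFormCertificate` (hypothesis form, axioms standard).

Disproof used (`Cruxes/PlecticRankUB/Disproof.lean`): §1 `plecticRankUB_false_without_analyticRank`
(p146677) is honoured at `stub_leadingFormCertificate` and re-certified here
(`leadingFormCertificate_false_without_analyticRank`: the other four stubs make the `r_an`-free
certificate FALSE); §5 stub kills p148822/p149022 avoided by shape (no sector split, no `r_an`-free
stub, no Selmer-cap stub); near-miss `not_plecticRankUBStrict` respected (the chain gives `≤ d`, tight
at `389a1 ⊗ ℚ(√D)`).

## Lead's log (prover-line-stmt-BirchSwinnertonDyer-17519-a1-0)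

* Cycle 1, reshape r1: `stub_lineData`, `stub_genericLine` restated with `IsLineOf` / `lineRestrict`
  unfolded to tree constants (definitionally equal, `isLineOf_iff`, `lineRestrict_eq`); both LANDED:
  `Theorems.stub_lineData` (p163515), `Theorems.stub_genericLine` (p163669) — their `sorry`s are gone.
* Cycle 1, reshape r2 (K2 audit, `work/stubs/StubTwoMaxInequality-audit.md`): as registered, K2 was
  stated for the CLASSICAL Selmer dual with NO correction at the TRIVIAL-ZERO primes — the primes
  `w ∣ p` of `K` that are alone over `F` (inert; ramified is excluded by `UnramifiedAbove`) at which
  `V_K` is (necessarily split) multiplicative: there the Tate period `q_w ∈ F_v^×` is a universal norm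
  from the local anticyclotomic tower on EVERY anticyclotomic line (`rec_w(q)` is `τ`-fixed and `τ`
  acts on `Γ` by inversion), the extended (Greenberg–Nekovář) dual `X̃` — the module the printed
  derived-height theorems (Howard, Amer. J. Math. 126 (2004) Thm 5.2 / Cor 5.3 / Rem 2.12; BD95;
  CHKLL 2023) and Howard's divisibility are about — sits in `0 → X_cl → X̃ → ⊕_w Λ ⊗_{Λ_w} ℤ_p → 0`,
  so `e(X̃) = e(X_cl) + δ` on lines ramified at the legs while the Mordell–Weil sides gain nothing:
  the registered inequality is false-expected on the leg sector (BD96 "non-split exceptional case",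
  Invent. 126 §1.10; `14a1`-type witness family, `e_cl = 1 < 2`). REPAIR (one module for both
  bounds, typed classically): the TRIVIAL-ZERO COUNT `δ = trivialZeroCount F K p V` is added to `e`
  in BOTH the lower bound (K2: `2(max − ρ) ≤ e + δ`) and the interface bound (`e + δ ≤ 2·ord(g|_a)`),
  i.e. both speak about `ẽ = e + δ`, the `T`-multiplicity of the extended dual; the composition is
  unchanged (`omega` on the same chain with `e + δ` for `e`), CERT's text is unchanged, and off the
  leg sector (`δ = 0`) K2 is the registered statement, printed for good ordinary reduction above `p`.
* Engine-freeness of the interface (K3 audit, `work/stubs/StubBoundingClassExists-audit.md`, kernel-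
  checked below as `boundingClass_of_genericBound`): `Nonempty (BoundingClass …)` follows from — and
  up to enlarging `h` is equivalent to — a GENERIC BOUND (constant `Λ`-rank and bounded `e + δ` off a
  hypersurface of directions), with `g := X₀^E`; so the minimal total order of a bounding class is
  `⌈(e + δ)_gen / 2⌉` and CERT ⇔ "`ρ ≤ d ∧ (e + δ)_gen ≤ 2(d − ρ)` at some admissible datum": the big
  Heegner class enters only a PROOF of CERT (as the `g` of a bounding class via Howard's
  divisibility), never the typing.
* Cycle 1, r3–r7: CERT UNFOLDED (`certAt_iff_genericCertificate`,
  `leadingFormCertificate_iff_genericCertificate`): given one bounding class, CERT ⇔ a GENERIC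
  CERTIFICATE (`rho ≤ d`, `E ≤ 2(d − rho)`, off a hypersurface `rank_Λ X = rho ∧ e + δ ≤ E`); helper
  stubs landed: P2' `order_lineSubst_eq_of_eval_leadingForm_ne_zero` (p165686), K2½ `stub_halfTwoMax`
  (p166213: `max(r⁺,r⁻) − ρ ≤ e`, any `ℤ_p`-extension, no heights), W5 `exists_five_le_mordellWeilRank`
  (p167302); consequences kernel-checked here: `mordellWeilRank_le_two_mul_of_leadingFormCertificate`
  (K3 → CERT → `rank V(F) ≤ 2d`, no K2) and `leadingFormCertificate_false_without_analyticRank_of_boundingClass`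
  (K3 alone makes the `r_an`-free certificate false: `W₅ ⊗ ℚ(√5)`, rank `≥ 5 > 4`).
-/

set_option linter.dupNamespace false

noncomputable section

open scoped Classical
open NumberField IsDedekindDomain Field
open Literature.NumberTheory.EllipticCurves Literature.NumberTheory.GaloisRepresentations

namespace Summit.BirchSwinnertonDyer.BirchSwinnertonDyer.Cruxes.PlecticRankUB.HeegnerLeadingFormPlecticCertificate

open Summit.BirchSwinnertonDyer.BirchSwinnertonDyer.Theses.PlecticLegs (PlecticRankUB)

/-! ### Vocabulary of the line (definitions; no axioms smuggled) -/

section Vocabulary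

variable (F : Type) [Field F] [NumberField F] (K : Type) [Field K] [NumberField K] [Algebra F K]
  (p : ℕ) [Fact p.Prime]

/-- A continuous character `f : Γ_K → ℤ_p` is **anticyclotomic over `F`** (`K/F` quadratic): every
`ρ ∈ Γ_F` outside the image of `Γ_K → Γ_F` (i.e. restricting to the non-trivial automorphism of
`K/F`) acts on `f` by inversion. Same shape as the tree's `ZpExtension.IsAnticyclotomic` (`F = ℚ`).
Ref: Greenberg, LNM 1716 §1; Howard, Compositio 140 (2004) §0. [folklore] -/
def IsAntiChar (f : absoluteGaloisGroup K →ₜ* Multiplicative ℤ_[p]) : Prop :=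
  ∀ (σ τ : absoluteGaloisGroup K) (ρ : absoluteGaloisGroup F),
    ρ ∉ Set.range (absGaloisRestrict F K) →
      absGaloisRestrict F K τ = ρ * absGaloisRestrict F K σ * ρ⁻¹ → f τ = (f σ)⁻¹

/-- A `ℤ_p`-extension `κ` of `K` is an **anticyclotomic line over `F`** if its defining character
is anticyclotomic over `F` (then `K_∞/F` is Galois and generalised dihedral). [folklore] -/
def IsAnticyclotomicOver (κ : ZpExtension K p) : Prop :=
  IsAntiChar F K p κ.toContinuousMonoidHom

variable {K p} in
/-- `κ` is **the line of direction `a`** of the `ℤ_p^n`-tower `Φ = (Φ₁,…,Φ_n)`: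
`κ = ∑ aᵢ Φᵢ` additively (`a ∈ ℕ^n`; integral directions are Zariski-dense). [folklore] -/
def IsLineOf {n : ℕ} (Φ : Fin n → (absoluteGaloisGroup K →ₜ* Multiplicative ℤ_[p]))
    (a : Fin n → ℕ) (κ : ZpExtension K p) : Prop :=
  ∀ σ, (κ σ).toAdd = ∑ i, (a i : ℤ_[p]) * (Φ i σ).toAdd

/-- `Φ = (Φ₁,…,Φ_n)` is a **maximal anticyclotomic `ℤ_p^n`-tower of `K` over `F`**: each `Φᵢ` is
anticyclotomic over `F`, `σ ↦ (Φᵢ σ)ᵢ : Γ_K → ℤ_p^n` is surjective, and EVERY anticyclotomic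
character is a `ℤ_p`-combination of the `Φᵢ` (the choice-free form of "the compositum of all
anticyclotomic `ℤ_p`-extensions", shape of the tree's `ZpExtension.zpRank_eq_nrComplexPlaces_add_one`;
for `K/F` CM of degree `2d` this is the `p^∞` ring-class tower, `n = d`).
Ref: Washington, Thm 13.4; Lang, *Cyclotomic Fields* Ch. 5 §5. [folklore] -/
def IsMaximalAnticyclotomicTower {n : ℕ}
    (Φ : Fin n → (absoluteGaloisGroup K →ₜ* Multiplicative ℤ_[p])) : Prop :=
  (∀ i, IsAntiChar F K p (Φ i)) ∧
    Function.Surjective (fun (σ : absoluteGaloisGroup K) (i : Fin n) => (Φ i σ).toAdd) ∧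
      ∀ f : absoluteGaloisGroup K →ₜ* Multiplicative ℤ_[p], IsAntiChar F K p f →
        ∃ c : Fin n → ℤ_[p], ∀ σ, (f σ).toAdd = ∑ i, c i * (Φ i σ).toAdd

variable {p} in
/-- `(1 + T)^c − 1 ∈ ℤ_p⟦T⟧`: the image of `Tᵢ = γᵢ − 1` under the quotient of the tower onto the
line of direction `a` (`γᵢ ↦ γ^{aᵢ}`). [folklore] -/
def lineGen (c : ℕ) : PowerSeries ℤ_[p] := (1 + PowerSeries.X) ^ c - 1

variable {p} in
/-- **Restriction of a `Λ_n`-adic class to the line of direction `a`**: the one-variable power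
series `g((1+T)^{a₁} − 1, …, (1+T)^{a_n} − 1)` (Mathlib `MvPowerSeries.subst`; the substituted
series have zero constant coefficient). [folklore] -/
def lineRestrict {n : ℕ} (a : Fin n → ℕ) (g : MvPowerSeries (Fin n) ℤ_[p]) : PowerSeries ℤ_[p] :=
  MvPowerSeries.subst (fun i => (lineGen (p := p) (a i) : MvPowerSeries Unit ℤ_[p])) g

variable (V : WeierstrassCurve F)

/-- **No `p`-torsion in `p`-power Galois extensions of `K`**: `V(L)[p] = 0` for every finite Galois
`L/K` of `p`-power degree (hence over every layer of every `ℤ_p`-line). Holds when `V[p]` is an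
irreducible `Γ_K`-module and `[K(V[p]):K]` is not a power of `p` (e.g. `p ≥ 5`, big image).
Ref: Howard, Compositio 140 (2004), hypotheses of §0. [folklore] -/
def NoPTorsionInPExtensions : Prop :=
  ∀ (L : Type) [Field L] [Algebra K L] [FiniteDimensional K L], IsGalois K L →
    (∃ k : ℕ, Module.finrank K L = p ^ k) →
      ∀ P : ((V.baseChange K).baseChange L).toAffine.Point, p • P = 0 → P = 0

/-- **Semistable-ordinary above `p`**: at every prime `w ∣ p` of `K`, `V_K` has good ordinary
(`HasGoodReductionAt ∧ HasUnitRootAt`, the tree's sanctioned spelling) or multiplicative reduction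
(the multiplicative primes above `p` inert in `K/F` are Fornea's LEGS). Greenberg, LNM 1716, Conj.
1.6 / Thm 1.14 hypothesis. [folklore] -/
def SemistableOrdinaryAbove : Prop :=
  ∀ w : HeightOneSpectrum (𝓞 K), (p : 𝓞 K) ∈ w.asIdeal →
    ((V.baseChange K).HasGoodReductionAt w ∧ (V.baseChange K).HasUnitRootAt w) ∨
      (V.baseChange K).HasMultiplicativeReductionAt w

/-- **`p` unramified in `K/F`**: every prime of `K` above `p` has ramification index `1` over
`𝓞 F` (Mathlib `Ideal.ramificationIdx`). [folklore] -/
def UnramifiedAbove : Prop :=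
  ∀ w : HeightOneSpectrum (𝓞 K), (p : 𝓞 K) ∈ w.asIdeal → w.asIdeal.ramificationIdx (𝓞 F) = 1

/-- **The trivial-zero primes (legs) of `(V, K, p)`**: the primes `w ∣ p` of `K` that are ALONE
over `F` (no other prime of `K` has the same contraction to `𝓞 F`; under `UnramifiedAbove`: `w`
inert over `F`, i.e. fixed by the CM involution `τ`) and at which `V_K` has multiplicative
reduction (necessarily SPLIT multiplicative: `K_w/F_v` is the unramified quadratic extension).
At such `w` the Tate period `q_w ∈ F_v^×` is a universal norm from the local anticyclotomic tower
on every anticyclotomic line, and the extended (Greenberg–Nekovář) Selmer dual exceeds the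
classical one by one `Λ/T`-unit (Bertolini–Darmon, Invent. Math. 126 (1996) §1.10, "non-split
exceptional case"; Mazur–Tate–Teitelbaum extended Mordell–Weil group). [folklore] -/
def trivialZeroPrimes : Set (HeightOneSpectrum (𝓞 K)) :=
  {w | (p : 𝓞 K) ∈ w.asIdeal ∧
    (∀ w' : HeightOneSpectrum (𝓞 K),
      w'.asIdeal.comap (algebraMap (𝓞 F) (𝓞 K)) = w.asIdeal.comap (algebraMap (𝓞 F) (𝓞 K)) →
        w' = w) ∧
    (V.baseChange K).HasMultiplicativeReductionAt w}

/-- **The trivial-zero count `δ(V, K, p)`**: the number of trivial-zero primes (`Set.ncard`; the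
set is finite, being contained in the primes above `p`). It is the shift between the
`T`-multiplicity `ẽ` of the extended Selmer dual and that, `e`, of the classical dual
`SelmerDualData` along an anticyclotomic line ramified at the legs: `ẽ = e + δ`. Off the leg
sector `δ = 0`. [folklore] -/
def trivialZeroCount : ℕ := (trivialZeroPrimes F K p V).ncard

/-- The finite place `v` of `F` **splits** in `K`: two distinct primes of `K` lie over it.
[folklore] -/
def SplitsIn (v : HeightOneSpectrum (𝓞 F)) : Prop :=
  ∃ w₁ w₂ : HeightOneSpectrum (𝓞 K), w₁ ≠ w₂ ∧
    w₁.asIdeal.comap (algebraMap (𝓞 F) (𝓞 K)) = v.asIdeal ∧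
      w₂.asIdeal.comap (algebraMap (𝓞 F) (𝓞 K)) = v.asIdeal

/-- The finite place `v` of `F` is **inert** in `K`: `v·𝓞_K` is prime. [folklore] -/
def InertIn (v : HeightOneSpectrum (𝓞 F)) : Prop :=
  (v.asIdeal.map (algebraMap (𝓞 F) (𝓞 K))).IsPrime

/-- **Generalised Heegner hypothesis** for `(V, K)`: every prime of bad reduction of `V` either
splits in `K` or is a multiplicative prime inert in `K` (so that a quaternion algebra over `F`,
definite or indefinite according to the parity of `d + #{inert bad primes}`, carries CM points / theta
elements for `(V, K)`). Ref: Zhang, Ann. of Math. 153 (2001) §1; Cornut–Vatsal (2007) §1; Fornea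
arXiv:2603.28327 Def 1.2. [folklore] -/
def HeegnerHypothesis : Prop :=
  ∀ v : HeightOneSpectrum (𝓞 F), ¬ V.HasGoodReductionAt v →
    SplitsIn F K v ∨ (V.HasMultiplicativeReductionAt v ∧ InertIn F K v)

/-- **Admissible configuration `(V, K, p)`** for the line (hypothesis bundle, a `Prop`): `p ≥ 5`;
`K/F` quadratic and totally complex (CM, `F` being totally real); `V/F` modular
(`WeierstrassCurve.IsModular`, the input shared by every line on this crux — FLS15 / DNS20 / Box22
for `d ≤ 3–4`, conjectural beyond); `V[p]` irreducible over `F`; no `p`-torsion in `p`-power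
Galois extensions of `K`; semistable-ordinary above `p`; `p` unramified in `K/F`; generalised
Heegner hypothesis. These are the standing hypotheses of Howard 2004/2006, CHKLL 2023 and Fornea
2026 (Ass. 1.4–1.7) transposed to `K/F`. [folklore] -/
structure Admissible : Prop where
  five_le : 5 ≤ p
  finrank_eq_two : Module.finrank F K = 2
  totallyComplex : IsTotallyComplex K
  modular : V.IsModular
  irreducible : V.HasIrreducibleModPGaloisRep p
  noPTorsion : NoPTorsionInPExtensions F K p V
  semistableOrdinary : SemistableOrdinaryAbove F K p V
  unramified : UnramifiedAbove F K p
  heegner : HeegnerHypothesis F K V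

/-- **INTERFACE (posited object): a `Λ_n`-adic BOUNDING CLASS for `V` on the tower `Φ`.** A nonzero
multivariable power series `g ∈ ℤ_p⟦T₁,…,T_n⟧` (intended: the coordinate of the big Heegner class
`𝛋^∞` — Howard / Fouquet / Fornea 2026 Thm 4 — in the indefinite branch `rho = 1`, resp. of the
theta element in the definite branch `rho = 0`, with respect to a generator of the rank-one compact
Selmer module), a nonzero polynomial `h` cutting out the exceptional directions, and the BOUND: along
every line `κ` of `Φ` of integral direction `a` with `h(a) ≠ 0`, for every topological generator
`γ` and every finitely generated dual datum `D` of `Sel_{p^∞}(V/K_∞)`, the Iwasawa module `D.X` has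
`Λ`-rank `rho` and the characteristic ideal of its `Λ`-torsion submodule contains a nonzero `f` with
`ord_T f + δ ≤ 2 · ord_T (g|_a)`, `δ = trivialZeroCount F K p V` — Howard's divisibility
`char X̃_tors ∣ (index of 𝛋^∞)²` for the EXTENDED dual, whose `T`-multiplicity along a line ramified
at the legs is `ord_T f + δ` (Howard 2006 Thm 3.2.3(c) / B; FG 2023 Thm 3.3), resp.
Bertolini–Darmon's `char X ∣ L_p = θ θ*`. (Reshape r2 of the lead: the registered interface had the
bound without `δ`, inconsistent with K2 on the leg sector — see the module docstring.) Existence is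
NOT a field: it is the construction statement `stub_boundingClass_exists`; by
`boundingClass_of_genericBound` below it is equivalent to an engine-free generic bound.
Ref: Howard, J. reine angew. Math. 597 (2006) Thm 3.2.3; Fornea–Gehrmann arXiv:2311.03100 Thm 3.3;
Bertolini–Darmon, Ann. of Math. 162 (2005) Thm 1. [cite: arXiv:2311.03100, Thm. 3.3] -/
structure BoundingClass {n : ℕ}
    (Φ : Fin n → (absoluteGaloisGroup K →ₜ* Multiplicative ℤ_[p])) where
  /-- generic `Λ`-rank of the Selmer dual along lines (`0` definite, `1` indefinite) -/
  rho : ℕ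
  /-- the class in coordinates: a multivariable power series over `ℤ_p` -/
  g : MvPowerSeries (Fin n) ℤ_[p]
  g_ne_zero : g ≠ 0
  /-- exceptional directions `{h = 0}` (lines unramified at a leg, control defects, …) -/
  h : MvPolynomial (Fin n) ℤ_[p]
  h_ne_zero : h ≠ 0
  /-- Howard / Bertolini–Darmon divisibility along every non-exceptional integral line -/
  bound : ∀ (a : Fin n → ℕ) (κ : ZpExtension K p) (γ : absoluteGaloisGroup K)
    (D : (V.baseChange K).SelmerDualData κ γ) [Module.Finite (IwasawaAlgebra p) D.X],
    IsLineOf Φ a κ → MvPolynomial.eval (fun i => (a i : ℤ_[p])) h ≠ 0 → κ.IsTopGenerator γ →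
      Module.finrank (IwasawaAlgebra p) D.X = rho ∧
        ∃ f ∈ Literature.NumberTheory.EllipticCurves.Module.charIdeal (IwasawaAlgebra p)
            ↥(Submodule.torsion (IwasawaAlgebra p) D.X),
          f ≠ 0 ∧ PowerSeries.order f + (trivialZeroCount F K p V : ℕ∞) ≤
            2 * PowerSeries.order (lineRestrict a g)

/-- **The leading-form certificate at `(F, V)`** (the shape of CERT, shared by the stub and by its
`r_an`-free negative below): there are an admissible `(K, p)` and a maximal anticyclotomic
`ℤ_p^n`-tower `Φ` (`n ≥ 1`) such that every bounding class of MINIMAL total order on `Φ` has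
`rho ≤ d` and total order (degree of its leading form) `≤ d − rho`, `d = [F:ℚ]`. [folklore] -/
def LeadingFormCertificate : Prop :=
  ∃ (K : Type) (_ : Field K) (_ : NumberField K) (_ : Algebra F K) (p : ℕ) (_ : Fact p.Prime)
    (n : ℕ) (Φ : Fin n → (absoluteGaloisGroup K →ₜ* Multiplicative ℤ_[p])),
    Admissible F K p V ∧ IsMaximalAnticyclotomicTower F K p Φ ∧ 0 < n ∧
      ∀ Δ : BoundingClass F K p V Φ,
        (∀ Δ' : BoundingClass F K p V Φ, MvPowerSeries.order Δ.g ≤ MvPowerSeries.order Δ'.g) →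
          Δ.rho ≤ Module.finrank ℚ F ∧
            MvPowerSeries.order Δ.g ≤ ((Module.finrank ℚ F - Δ.rho : ℕ) : ℕ∞)

end Vocabulary

/-! ### Registered stubs -/

/-- Stub **K2 — the parity-free TWO-MAX inequality over `K/F`** (derived `p`-adic heights along an
anticyclotomic line). For `K/F` CM quadratic (`F` totally real, `p ≥ 5` unramified in `K/F`),
`κ` an anticyclotomic `ℤ_p`-line of `K` over `F` with topological generator `γ`, `V/F` elliptic
with no `p`-torsion in `p`-power extensions of `K` and semistable-ordinary above `p`, and `D` a
finitely generated dual datum of `Sel_{p^∞}(V/K_∞)`: every nonzero `f` in the characteristic ideal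
of the `Λ`-torsion submodule of `X = D.X` satisfies
`2 · (max(r⁺, r⁻) − rank_Λ X) ≤ ord_T f`, with `r⁺ = rank V(F)`, `r⁻ = rank V(K) − rank V(F)`
(Mordell–Weil ranks: the weakest, hence safe, form — the Selmer / BD-extended ranks `r̃± = r± + δ±`
of FG 2023 Conj 2.13 only strengthen the left side, TRIAGE-r2-2, r2-3). Mechanism: the derived height
filtration `S^{(1)} ⊇ S^{(2)} ⊇ …` on the `ℚ_p`-dual of `X/TX` has `∑ᵢ (dim S^{(i)} − ρ) = e`,
`h^{(1)}` is `τ`-anti-equivariant so its null-space has dimension `≥ |s⁺ − s⁻|`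
(tree `Literature.Barriers.BirchSwinnertonDyer.finrank_plusPart_le`), whence
`e ≥ 2·max(s⁺ − ρ⁺, s⁻ − ρ⁻) ≥ 2(max(r⁺,r⁻) − ρ)`. In print: `F = ℚ`, `ρ = 0`: Bertolini–Darmon 1995
Thm 2.18/2.23 + §3; `ρ = 1`: Howard 2004 Thm B, CHKLL arXiv:2308.10474 Thm 1.5(ii)/Cor 6.13 (with
equality iff `h_p` maximally non-degenerate); general `K/F`, self-dual Greenberg conditions:
Nekovář, *Selmer complexes* §11. RESHAPE r2 (lead, cycle 1; audit
`work/stubs/StubTwoMaxInequality-audit.md`): the registered form (`… ≤ ord_T f`, no `δ`) is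
false-expected on the leg sector, because `D` is the CLASSICAL dual: at a trivial-zero prime
(`trivialZeroPrimes`) the extended dual `X̃` — the module carrying the `τ`-compatible Λ-adic duality
and the derived heights — satisfies `0 → X_cl → X̃ → ⊕_w Λ ⊗_{Λ_w} ℤ_p → 0`, so `ẽ = e + δ` on lines
ramified at the legs while the Mordell–Weil sides gain nothing (`14a1`-type witness family:
`r⁺ = 0`, `r⁻ = 1`, `ρ = 0`, `ẽ = 2`, `e = 1 < 2`). The corrected conclusion bounds by `ord_T f + δ`,
`δ = trivialZeroCount F K p V` (the count of ALL trivial-zero primes: on a line unramified at a leg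
that leg costs nothing, audit (b), so the uniform `δ` is the weak = safe side). PRINTED CASE
(`δ = 0`, `F = ℚ`, good ordinary above `p`, `p` split or inert, every bad prime split in `K`, any
`ρ`): Howard, Amer. J. Math. 126 (2004) §4–5, Thm 5.2 + Cor 5.3 + Rem 2.12 (classical dual);
BD95 Thm 2.18/2.23 under perfect control. Why it might fail: the `K/F` transposition and the
trivial-zero bookkeeping `ẽ = e + δ` along a line ramified at several legs are unprinted
(TRIAGE-r2-1 (4), r2-2 (4)); blockers B1–B3 of the audit (τ-action on `D.X`, ±-control, Λ-adic
Cassels–Tate / derived heights) have no tree counterpart. Size XL.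
[cite: arXiv:2308.10474, Thm. 1.5] -/
theorem stub_twoMaxInequality :
    ∀ (F : Type) [Field F] [NumberField F] [IsTotallyReal F]
      (K : Type) [Field K] [NumberField K] [Algebra F K] [IsTotallyComplex K]
      (V : WeierstrassCurve F) [V.IsElliptic] (p : ℕ) [Fact p.Prime]
      (κ : ZpExtension K p) (γ : absoluteGaloisGroup K)
      (D : (V.baseChange K).SelmerDualData κ γ) [Module.Finite (IwasawaAlgebra p) D.X],
      Module.finrank F K = 2 → 5 ≤ p → IsAnticyclotomicOver F K p κ → κ.IsTopGenerator γ →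
      NoPTorsionInPExtensions F K p V → SemistableOrdinaryAbove F K p V → UnramifiedAbove F K p →
      ∀ f ∈ Literature.NumberTheory.EllipticCurves.Module.charIdeal (IwasawaAlgebra p)
          ↥(Submodule.torsion (IwasawaAlgebra p) D.X), f ≠ 0 →
        ((2 * (max V.mordellWeilRank ((V.baseChange K).mordellWeilRank - V.mordellWeilRank) -
            Module.finrank (IwasawaAlgebra p) D.X) : ℕ) : ℕ∞) ≤
          PowerSeries.order f + (trivialZeroCount F K p V : ℕ∞) := by
  sorry

/-- Stub **K3 — EXISTENCE OF A BOUNDING CLASS on the maximal anticyclotomic tower** (construction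
statement for the interface `BoundingClass`; theorem-shaped, XL). For `(V, K, p)` admissible and
`Φ` the maximal anticyclotomic `ℤ_p^n`-tower of `K` over `F`, a bounding class exists: by the
generalised Heegner hypothesis exactly one of the definite / indefinite quaternion algebras over `F`
attached to `(V, K)` exists; INDEFINITE: the big Heegner class `𝛋^∞` of CM points of `p`-power
conductor on the Shimura curve (Fouquet 2013; Fornea 2026 Thm 4 on the leg sector), nonzero by
Cornut–Vatsal, bounds `char X_tors` along every line ramified at all legs by Howard's bipartite
Euler system (Howard 2006 Thm 3.2.3; over `F`: Longo 2012 + Nekovář 2012 level raising + Wang 2023,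
assembled as in Fornea–Gehrmann 2023 Thm 3.3), `rho = 1`; DEFINITE: the theta element `θ_∞`,
nonzero by Cornut–Vatsal, with `char X ∣ θ θ*` (Bertolini–Darmon 2005; over `F`: Longo 2012, Wang
2023), `rho = 0`; CM curves: Agboola–Howard. The exceptional polynomial `h` collects the lines
unramified at some leg (Tunnell–Saito vanishing: `𝛋^∞ ∈ ∏_𝔭 I_𝔭`, TRIAGE-r2-3 (i)) and the control
defect of the compact Selmer module under restriction to a line. Why it might fail: every ingredient
is printed over `F` but the assembly along a line ramified at `d − 1` legs with (CR)-type hypotheses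
is not (card K3; TRIAGE-r2-1, r2-2, r2-3). [cite: arXiv:2311.03100, Thm. 3.3] -/
theorem stub_boundingClass_exists :
    ∀ (F : Type) [Field F] [NumberField F] [IsTotallyReal F]
      (K : Type) [Field K] [NumberField K] [Algebra F K]
      (V : WeierstrassCurve F) [V.IsElliptic] (p : ℕ) [Fact p.Prime] (n : ℕ)
      (Φ : Fin n → (absoluteGaloisGroup K →ₜ* Multiplicative ℤ_[p])),
      Admissible F K p V → IsMaximalAnticyclotomicTower F K p Φ →
        Nonempty (BoundingClass F K p V Φ) := by
  sorry

/-- Stub **K1 — the LEADING-FORM CERTIFICATE (CERT; the line's conjecture-sized stub, the HARDEST,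
and the ONLY stub that consumes `V.analyticRank = [F:ℚ]`).** For `V/F` in the plectic regime
(`d = [F:ℚ] ≥ 2`, `r_an(V/F) = d`) there are an admissible `(K, p)` and a maximal anticyclotomic
`ℤ_p^n`-tower `Φ` of `K` (`n ≥ 1`) on which every bounding class of MINIMAL total order has
`rho ≤ d` and leading form of degree `≤ d − rho`. By `stub_twoMaxInequality` the degree is FORCED
`≥ max(r⁺,r⁻) − rho`, so on a curve of rank `d` this says "minimal degree exactly `d − rho`"
(card: `ν = d − 1`). ENGINE (indefinite branch, exceptional sector = `≥ d − 1` NON-SPLIT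
multiplicative legs above one `p`, all inert in `K`, degree one over `ℚ_p`): Tunnell–Saito puts
`𝛋^∞` in `∏_𝔭 I_𝔭`, so modulo `I^d` the leading form is `c · T₁⋯T_{d−1}` and `c`, the MIXED
coefficient, is `(∏ ord_𝔭 q_𝔭) · κ_{V,𝒮}` — Fornea's plectic Heegner class (FG 2023 Lemma 3.11 +
Fornea 2026 Thm 2, printed for one leg and `F = ℚ`; card K4 for `|𝒮| ≥ 2`); `κ_{V,𝒮} ≠ 0 ⟸
r_an(V/K) = d` is the `r_an`-keyed PLECTIC GROSS–ZAGIER non-vanishing (Nekovář–Scholl; Fornea 2026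
Conj 1.9–1.10; FGM Conj 6.8/6.10) that crux 17518 `PlecticPointsLB` already stakes the route on —
one conjecture for the route, not two; at `d ≥ 3` it contains a `p`-adic `(d−1)`-minor condition on
Tate-period logarithms over the finite set of admissible `(p, 𝒮)` (TRIAGE-r2-1 (2), r2-3 (2)).
OFF the sector (and in the definite branch) the certificate is the engine-less Bertolini–Darmon /
Howard leading-term statement (`h^{(2)}` maximally non-degenerate ∧ main-conjecture equality at some
datum): CONCEDED (card; TRIAGE-r2-2 (1)/(3)); modularity of `V/F` rides inside `Admissible`.
Why it might fail: off-sector `PAdicHeightNondegeneracy` bites squarely; on-sector it is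
PLECTIC-GZ_d + K4, both open. [cite: arXiv:2603.28327, Conj. 1.10] -/
theorem stub_leadingFormCertificate :
    ∀ (F : Type) [Field F] [NumberField F] [IsTotallyReal F] (V : WeierstrassCurve F) [V.IsElliptic],
      2 ≤ Module.finrank ℚ F → V.analyticRank = Module.finrank ℚ F →
        LeadingFormCertificate F V := by
  sorry

/-- Stub **P — LINE DATA (known; Greenberg, LNM 1716 §1 + Nakayama; M–L).** For a jointly
surjective family `Φ : Γ_K → ℤ_p^n` and an integral direction `a` with some `p ∤ aᵢ`, the
character `∑ aᵢ Φᵢ` is surjective, i.e. a `ℤ_p`-extension `κ` (the line of direction `a`); it has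
a topological generator `γ`; and for every elliptic curve `W/K` the Pontryagin dual of
`Sel_{p^∞}(W/K_∞)` carries a `Λ`-module structure with `T = γ − 1` (a `SelmerDualData`, tree named
fact `nonempty_selmerDualData`) which is finitely generated (`SelmerDualData.module_finite`:
`X/𝔪X` is dual to `Sel_∞[p]^Γ`, finite by inflation–restriction from `H¹(K_Σ/K, W[p])`, for ANY
`ℤ_p`-extension). Why it might fail: it does not — routine but the `Λ`-structure on the dual has to
be built honestly (continuity of the `ℤ_p⟦T⟧`-action).
RESHAPED by the lead (cycle 1, statement unchanged up to unfolding): `IsLineOf Φ a κ` is written out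
(`∀ σ, (κ σ).toAdd = ∑ i, (a i : ℤ_[p]) * (Φ i σ).toAdd`) so that the registered signature mentions
tree constants only and the stub can land as a plain `Theorems/` proof file; the Selmer half is the
tree's `WeierstrassCurve.nonempty_selmerDualData_holds` + `SelmerDualData.module_finite_of_inertia_le`
+ `ZpExtension.inertia_le_kerSubgroup_holds` (finite generation for EVERY `ℤ_p`-extension).
LANDED (cycle 1, wave 1): `Summit.BirchSwinnertonDyer.BirchSwinnertonDyer.Theorems.stub_lineData`,
file `Theorems/PlecticLegsPlecticRankUBStubLineData.lean`, p163515.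
[cite: GreenbergLNM1716, §1 Thm. 1.3] -/
theorem stub_lineData :
    ∀ (K : Type) [Field K] [NumberField K] (p : ℕ) [Fact p.Prime] (n : ℕ)
      (Φ : Fin n → (absoluteGaloisGroup K →ₜ* Multiplicative ℤ_[p])) (a : Fin n → ℕ),
      Function.Surjective (fun (σ : absoluteGaloisGroup K) (i : Fin n) => (Φ i σ).toAdd) →
      (∃ i, ¬ p ∣ a i) →
        ∃ κ : ZpExtension K p, (∀ σ, (κ σ).toAdd = ∑ i, (a i : ℤ_[p]) * (Φ i σ).toAdd) ∧
          ∃ γ : absoluteGaloisGroup K, κ.IsTopGenerator γ ∧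
            ∀ (W : WeierstrassCurve K) [W.IsElliptic],
              ∃ D : W.SelmerDualData κ γ, Module.Finite (IwasawaAlgebra p) D.X :=
  _root_.Summit.BirchSwinnertonDyer.BirchSwinnertonDyer.Theorems.stub_lineData

/-- Stub **P2 — GENERIC LINE ORDER (pure algebra, provable now; M).** For a nonzero
`g ∈ ℤ_p⟦T₁,…,T_n⟧` and a nonzero polynomial `h`, there is an integral direction `a ∈ ℕ^n` with
every `aᵢ` prime to `p` (so the line exists), `h(a) ≠ 0`, and
`ord_T g((1+T)^{a₁}−1, …, (1+T)^{a_n}−1) = ord(g)` (total order = degree `ν` of the leading form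
`g_ν`): the coefficient of `T^ν` of the restriction is `g_ν(a)` (each substituted series is
`aᵢT + O(T²)`, Mathlib `MvPowerSeries.le_order_subst` gives `≥ ν`), and `g_ν · h ≠ 0` does not
vanish identically on the grid `{1, 1+p, 1+2p, …}^n` (Mathlib
`MvPolynomial.eq_zero_of_eval_zero_at_prod_finset`, Alon's Nullstellensatz, `ℤ_p` a domain). On
the exceptional sector `g_ν = c·T₁⋯T_{d−1}` and the statement reduces to "`∏ aᵢ ≠ 0`" = "the line is
ramified at every leg" (TRIAGE-r2-3 (i)). Why it might fail: it does not (first deliverable; card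
P2, all three triagers). RESHAPED by the lead (cycle 1, statement unchanged up to unfolding):
`lineRestrict a g` is written out as the `MvPowerSeries.subst` of the series `(1 + X)^{aᵢ} − 1`
(definitionally `lineRestrict`, see `lineRestrict_eq`) so that the registered signature mentions
Mathlib constants only and the stub lands as a plain `Theorems/` proof file. LANDED (cycle 1, wave 1):
`Summit.BirchSwinnertonDyer.BirchSwinnertonDyer.Theorems.stub_genericLine`, file
`Theorems/PlecticLegsPlecticRankUBStubGenericLine.lean`, p163669. [folklore] -/
theorem stub_genericLine :
    ∀ (p : ℕ) [Fact p.Prime] (n : ℕ) (g : MvPowerSeries (Fin n) ℤ_[p])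
      (h : MvPolynomial (Fin n) ℤ_[p]), g ≠ 0 → h ≠ 0 →
        ∃ a : Fin n → ℕ, (∀ i, ¬ p ∣ a i) ∧ MvPolynomial.eval (fun i => (a i : ℤ_[p])) h ≠ 0 ∧
          PowerSeries.order (MvPowerSeries.subst
            (fun i => (((1 + PowerSeries.X : PowerSeries ℤ_[p]) ^ (a i) - 1 : PowerSeries ℤ_[p]) :
              MvPowerSeries Unit ℤ_[p])) g) = MvPowerSeries.order g :=
  _root_.Summit.BirchSwinnertonDyer.BirchSwinnertonDyer.Theorems.stub_genericLine

/-- Stub **P2' — POINTWISE GENERIC LINE ORDER (pure algebra; helper stub registered by the lead,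
cycle 1, so that the public form of the landed file's private `order_subst_line_eq` can ride with
`--supports`).** If `f ∈ R⟦T₁,…,T_n⟧` has total order `N` and its leading form
`f_N = truncFinset R (univ.finsuppAntidiag N) f` does not vanish at the integral direction `a`, the
restriction `f((1+T)^{a₁} − 1, …)` has `T`-order exactly `N`. Used by `BoundingClass.genericBound`
(CERT unfolded). LANDED: `Theorems.order_lineSubst_eq_of_eval_leadingForm_ne_zero`, appended to
`Theorems/PlecticLegsPlecticRankUBStubGenericLine.lean`, p165686. [folklore] -/
theorem order_lineSubst_eq_of_eval_leadingForm_ne_zero :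
    ∀ (R : Type) [CommRing R] (n : ℕ) (f : MvPowerSeries (Fin n) R) (a : Fin n → ℕ) (N : ℕ),
      f.order = N →
      MvPolynomial.eval (fun i => (a i : R))
        (MvPowerSeries.truncFinset R ((Finset.univ : Finset (Fin n)).finsuppAntidiag N) f) ≠ 0 →
        PowerSeries.order (MvPowerSeries.subst
          (fun i => (((1 + PowerSeries.X : PowerSeries R) ^ (a i) - 1 : PowerSeries R) :
            MvPowerSeries Unit R)) f) = N :=
  _root_.Summit.BirchSwinnertonDyer.BirchSwinnertonDyer.Theorems.order_lineSubst_eq_of_eval_leadingForm_ne_zero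

/-- Stub **K2½ — HALF-STRENGTH TWO-MAX (helper stub registered by the lead, cycle 1; PROVABLE and
LANDED p166213: `Theorems.stub_halfTwoMax`, file `Theorems/PlecticLegsPlecticRankUBStubHalfTwoMax.lean`).** For number fields `F → K`, `V/F`
elliptic, ANY `ℤ_p`-extension `κ` of `K` with topological generator `γ`, any finitely generated dual
datum `D` of `Sel_{p^∞}(V_K/K_∞)` and any `f ∈ char_Λ((D.X)_tors)`:
`max(r⁺, r⁻) − rank_Λ D.X ≤ ord_T f`. This is the `k = 1` term of K2's derived-height filtration
(`rank V(K) ≤ rank_{ℤ_p} X/TX ≤ rank_Λ X + ℓ_(T)(X_tors)`: Kummer/control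
`mordellWeilRank_le_coinvariantsRank` + `Λ_(T)` a DVR), with factor `1` instead of `2`, no `τ`, no
duality, no reduction hypothesis. With the interface bound it already gives
`rank V(F) ≤ 2d − ρ` from CERT + K3 alone (`mordellWeilRank_le_two_mul_of_leadingFormCertificate`).
[cite: GreenbergLNM1716, §1 p. 65] -/
theorem stub_halfTwoMax :
    ∀ (F : Type) [Field F] [NumberField F] (K : Type) [Field K] [NumberField K] [Algebra F K]
      (V : WeierstrassCurve F) [V.IsElliptic] (p : ℕ) [Fact p.Prime]
      (κ : ZpExtension K p) (γ : Field.absoluteGaloisGroup K)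
      (D : (V.baseChange K).SelmerDualData κ γ) [Module.Finite (IwasawaAlgebra p) D.X],
      κ.IsTopGenerator γ →
      ∀ f ∈ Literature.NumberTheory.EllipticCurves.Module.charIdeal (IwasawaAlgebra p)
          ↥(Submodule.torsion (IwasawaAlgebra p) D.X),
        ((max V.mordellWeilRank ((V.baseChange K).mordellWeilRank - V.mordellWeilRank) -
            Module.finrank (IwasawaAlgebra p) D.X : ℕ) : ℕ∞) ≤ PowerSeries.order f :=
  _root_.Summit.BirchSwinnertonDyer.BirchSwinnertonDyer.Theorems.stub_halfTwoMax

/-- Stub **W5 — A RATIONAL ELLIPTIC CURVE OF RANK AT LEAST FIVE (helper stub registered by the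
lead; LANDED p167302: `Theorems.exists_five_le_mordellWeilRank`, file
`Theorems/PlecticLegsPlecticRankUBRankFiveWitness.lean` — a kernel-checked complete `2`-descent
certificate `5 ≤ rank` for `y² = x(x − 1504)(x + 1522)` with the integral points of abscissae
`−1521, −1504, −1369, −1250, −846`, found by the lead's local Mestre–Nagao-prefiltered search).** Used by
`leadingFormCertificate_false_without_analyticRank_of_boundingClass`: over the real quadratic field
`ℚ(√5)` (`d = 2`) its base change has rank `≥ 5 > 2d`. [cite: SilvermanAEC2009, Prop. X.1.4] -/
theorem exists_five_le_mordellWeilRank :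
    ∃ (W : WeierstrassCurve ℚ) (_ : W.IsElliptic), 5 ≤ W.mordellWeilRank :=
  _root_.Summit.BirchSwinnertonDyer.BirchSwinnertonDyer.Theorems.exists_five_le_mordellWeilRank

/-! ### Glue (proved) -/

section Glue

variable {F : Type} [Field F] [NumberField F] {K : Type} [Field K] [NumberField K] [Algebra F K]
  {p : ℕ} [Fact p.Prime]

omit [NumberField F] [NumberField K] in
/-- A line of a tower of anticyclotomic characters is anticyclotomic (a `ℤ_p`-combination of
characters inverted by `ρ` is inverted by `ρ`). [folklore] -/
theorem isAnticyclotomicOver_of_isLineOf {n : ℕ}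
    {Φ : Fin n → (absoluteGaloisGroup K →ₜ* Multiplicative ℤ_[p])}
    (hΦ : ∀ i, IsAntiChar F K p (Φ i)) {a : Fin n → ℕ} {κ : ZpExtension K p}
    (hline : IsLineOf Φ a κ) : IsAnticyclotomicOver F K p κ := by
  intro σ τ ρ hρ hconj
  apply Multiplicative.toAdd.injective
  change (κ τ).toAdd = ((κ σ)⁻¹).toAdd
  rw [toAdd_inv, hline τ, hline σ, ← Finset.sum_neg_distrib]
  refine Finset.sum_congr rfl fun i _ => ?_
  rw [hΦ i σ τ ρ hρ hconj, toAdd_inv, mul_neg]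

/-- The substituted series `(1+T)^{aᵢ} − 1` have zero constant coefficient, so the substitution
defining `lineRestrict` is legitimate (`MvPowerSeries.HasSubst`), not the junk value `0`: the
restriction to a line is the honest image of `g`. [folklore] -/
theorem hasSubst_lineGen {n : ℕ} (a : Fin n → ℕ) :
    MvPowerSeries.HasSubst (fun i => (lineGen (p := p) (a i) : MvPowerSeries Unit ℤ_[p])) := by
  refine MvPowerSeries.hasSubst_of_constantCoeff_zero fun i => ?_
  change PowerSeries.constantCoeff (lineGen (p := p) (a i)) = 0
  simp [lineGen]

/-- `lineRestrict a` is the algebra homomorphism `MvPowerSeries.substAlgHom` of the legitimate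
substitution. [folklore] -/
theorem lineRestrict_eq_substAlgHom {n : ℕ} (a : Fin n → ℕ) (g : MvPowerSeries (Fin n) ℤ_[p]) :
    lineRestrict a g = MvPowerSeries.substAlgHom (hasSubst_lineGen (p := p) a) g :=
  (MvPowerSeries.substAlgHom_apply (hasSubst_lineGen (p := p) a) g).symm

/-- `lineRestrict a g` unfolded to Mathlib constants (the form in which `stub_genericLine` is
registered and landed): the substitution of the series `(1 + X)^{aᵢ} − 1`. [folklore] -/
theorem lineRestrict_eq {n : ℕ} (a : Fin n → ℕ) (g : MvPowerSeries (Fin n) ℤ_[p]) :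
    lineRestrict a g = MvPowerSeries.subst
      (fun i => (((1 + PowerSeries.X : PowerSeries ℤ_[p]) ^ (a i) - 1 : PowerSeries ℤ_[p]) :
        MvPowerSeries Unit ℤ_[p])) g := rfl

omit [NumberField K] in
/-- `IsLineOf Φ a κ` unfolded (the form in which `stub_lineData` is registered and landed).
[folklore] -/
theorem isLineOf_iff {n : ℕ} (Φ : Fin n → (absoluteGaloisGroup K →ₜ* Multiplicative ℤ_[p]))
    (a : Fin n → ℕ) (κ : ZpExtension K p) :
    IsLineOf Φ a κ ↔ ∀ σ, (κ σ).toAdd = ∑ i, (a i : ℤ_[p]) * (Φ i σ).toAdd := Iff.rfl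

end Glue

/-! ### Composition -/

/-- **The chain at one curve.** Given the two XL theorem-shaped stubs (two-max K2, bounding class
K3) as hypotheses and the two LANDED stubs (`stub_lineData`, `stub_genericLine`) as theorems, the
leading-form certificate at `(F, V)` caps the rank:
`2(max(r⁺,r⁻) − ρ) ≤ ord_T f + δ ≤ 2·ord_T(g|_a) = 2·ord g ≤ 2(d − ρ)`, hence
`rank V(F) = r⁺ ≤ max(r⁺,r⁻) ≤ d` (`omega`; no parity, no descent; `δ` = trivial-zero count).
[folklore] -/
theorem mordellWeilRank_le_of_leadingFormCertificate
    (h2 : ∀ (F : Type) [Field F] [NumberField F] [IsTotallyReal F]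
      (K : Type) [Field K] [NumberField K] [Algebra F K] [IsTotallyComplex K]
      (V : WeierstrassCurve F) [V.IsElliptic] (p : ℕ) [Fact p.Prime]
      (κ : ZpExtension K p) (γ : absoluteGaloisGroup K)
      (D : (V.baseChange K).SelmerDualData κ γ) [Module.Finite (IwasawaAlgebra p) D.X],
      Module.finrank F K = 2 → 5 ≤ p → IsAnticyclotomicOver F K p κ → κ.IsTopGenerator γ →
      NoPTorsionInPExtensions F K p V → SemistableOrdinaryAbove F K p V → UnramifiedAbove F K p →
      ∀ f ∈ Literature.NumberTheory.EllipticCurves.Module.charIdeal (IwasawaAlgebra p)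
          ↥(Submodule.torsion (IwasawaAlgebra p) D.X), f ≠ 0 →
        ((2 * (max V.mordellWeilRank ((V.baseChange K).mordellWeilRank - V.mordellWeilRank) -
            Module.finrank (IwasawaAlgebra p) D.X) : ℕ) : ℕ∞) ≤
          PowerSeries.order f + (trivialZeroCount F K p V : ℕ∞))
    (h3 : ∀ (F : Type) [Field F] [NumberField F] [IsTotallyReal F]
      (K : Type) [Field K] [NumberField K] [Algebra F K]
      (V : WeierstrassCurve F) [V.IsElliptic] (p : ℕ) [Fact p.Prime] (n : ℕ)
      (Φ : Fin n → (absoluteGaloisGroup K →ₜ* Multiplicative ℤ_[p])),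
      Admissible F K p V → IsMaximalAnticyclotomicTower F K p Φ →
        Nonempty (BoundingClass F K p V Φ))
    (F : Type) [Field F] [NumberField F] [IsTotallyReal F] (V : WeierstrassCurve F) [V.IsElliptic]
    (hcert : LeadingFormCertificate F V) :
    V.mordellWeilRank ≤ Module.finrank ℚ F := by
  obtain ⟨K, _, _, _, p, _, n, Φ, hadm, hmax, hn, hmin⟩ := hcert
  -- a bounding class of minimal total order exists (construction stub + well-ordering of ℕ)
  have hex : ∃ m : ℕ, ∃ Δ : BoundingClass F K p V Φ, MvPowerSeries.order Δ.g = m := by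
    obtain ⟨Δ₀⟩ := h3 F K V p n Φ hadm hmax
    exact ⟨(MvPowerSeries.order Δ₀.g).toNat, Δ₀,
      ((MvPowerSeries.ne_zero_iff_order_finite).mp Δ₀.g_ne_zero).symm⟩
  obtain ⟨Δ, hΔ⟩ := Nat.find_spec hex
  have hΔmin : ∀ Δ' : BoundingClass F K p V Φ,
      MvPowerSeries.order Δ.g ≤ MvPowerSeries.order Δ'.g := by
    intro Δ'
    have h' : MvPowerSeries.order Δ'.g = ((MvPowerSeries.order Δ'.g).toNat : ℕ∞) :=
      ((MvPowerSeries.ne_zero_iff_order_finite).mp Δ'.g_ne_zero).symm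
    have hle : Nat.find hex ≤ (MvPowerSeries.order Δ'.g).toNat := Nat.find_min' hex ⟨Δ', h'⟩
    rw [hΔ, h']
    exact_mod_cast hle
  obtain ⟨hρd, hordg⟩ := hmin Δ hΔmin
  -- a generic integral line on which the restriction has the total order of `g` (LANDED P2)
  obtain ⟨a, hunit, hha, horda⟩ := stub_genericLine p n Δ.g Δ.h Δ.g_ne_zero Δ.h_ne_zero
  have horda' : PowerSeries.order (lineRestrict a Δ.g) = MvPowerSeries.order Δ.g := by
    rw [lineRestrict_eq]; exact horda
  -- the line as a `ℤ_p`-extension with a finitely generated Selmer dual datum (LANDED P)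
  obtain ⟨κ, hline, γ, hγ, hD⟩ := stub_lineData K p n Φ a hmax.2.1 ⟨⟨0, hn⟩, hunit ⟨0, hn⟩⟩
  have hline' : IsLineOf Φ a κ := (isLineOf_iff Φ a κ).2 hline
  haveI : (V.baseChange K).IsElliptic := inferInstanceAs (V.map (algebraMap F K)).IsElliptic
  obtain ⟨D, hfin⟩ := hD (V.baseChange K)
  haveI := hfin
  haveI : IsTotallyComplex K := hadm.totallyComplex
  -- the interface bound along the line (Howard / Bertolini–Darmon divisibility for `e + δ`)
  obtain ⟨hrank, f, hf, hf0, hfle⟩ := Δ.bound a κ γ D hline' hha hγ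
  -- the two-max inequality along the line (stub K2, for `e + δ`)
  have hanti : IsAnticyclotomicOver F K p κ := isAnticyclotomicOver_of_isLineOf hmax.1 hline'
  have h2' := h2 F K V p κ γ D hadm.finrank_eq_two hadm.five_le hanti hγ hadm.noPTorsion
    hadm.semistableOrdinary hadm.unramified f hf hf0
  rw [hrank] at h2'
  -- arithmetic in ℕ∞ and ℕ
  have hg : MvPowerSeries.order Δ.g = ((MvPowerSeries.order Δ.g).toNat : ℕ∞) :=
    ((MvPowerSeries.ne_zero_iff_order_finite).mp Δ.g_ne_zero).symm
  set m := (MvPowerSeries.order Δ.g).toNat with hm_def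
  have hm : m ≤ Module.finrank ℚ F - Δ.rho := by
    rw [hg] at hordg
    exact_mod_cast hordg
  have hchain :
      ((2 * (max V.mordellWeilRank ((V.baseChange K).mordellWeilRank - V.mordellWeilRank) -
          Δ.rho) : ℕ) : ℕ∞) ≤ ((2 * m : ℕ) : ℕ∞) :=
    calc ((2 * (max V.mordellWeilRank ((V.baseChange K).mordellWeilRank - V.mordellWeilRank) -
            Δ.rho) : ℕ) : ℕ∞)
          ≤ PowerSeries.order f + (trivialZeroCount F K p V : ℕ∞) := h2'
      _ ≤ 2 * PowerSeries.order (lineRestrict a Δ.g) := hfle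
      _ = 2 * MvPowerSeries.order Δ.g := by rw [horda']
      _ = ((2 * m : ℕ) : ℕ∞) := by rw [hg]; push_cast; rfl
  have hchain' :
      2 * (max V.mordellWeilRank ((V.baseChange K).mordellWeilRank - V.mordellWeilRank) -
          Δ.rho) ≤ 2 * m := by
    exact_mod_cast hchain
  have hM : max V.mordellWeilRank ((V.baseChange K).mordellWeilRank - V.mordellWeilRank) ≤
      Module.finrank ℚ F := by
    omega
  exact le_trans (le_max_left _ _) hM

/-- **Composition of line `heegner-leading-form-plectic-certificate` (the registered skeleton
theorem).** Concludes the crux `PlecticRankUB` BY NAME, with NO hypotheses, from the declared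
stubs invoked by name (every one consumed; `sorry` lives only inside the three open `stub_*`): CERT
(`stub_leadingFormCertificate`) picks an admissible `(K, p)` and the maximal anticyclotomic tower;
the construction stub (`stub_boundingClass_exists`) gives a bounding class, hence one of minimal
total order; GENERIC LINE (`stub_genericLine`, landed) picks an integral direction realising the
total order and avoiding the exceptional hypersurface; LINE DATA (`stub_lineData`, landed) realises
the line as a `ℤ_p`-extension with a finitely generated Selmer dual datum; the bounding class bounds
`ord_T char X_tors + δ` from above and TWO-MAX (`stub_twoMaxInequality`) bounds it from below;
`omega` (all in the sorry-free `mordellWeilRank_le_of_leadingFormCertificate`). [folklore] -/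
theorem PlecticRankUB_of : PlecticRankUB := by
  intro F _ _ _ V _ hd hran
  exact mordellWeilRank_le_of_leadingFormCertificate stub_twoMaxInequality stub_boundingClass_exists
    F V (stub_leadingFormCertificate F V hd hran)

/-- **What the line proves WITHOUT derived heights (K2 replaced by its landed `k = 1` half).**
Given only the construction stub K3, the leading-form certificate at `(F, V)` caps the rank by
`2d − ρ ≤ 2d`: `max(r⁺,r⁻) − ρ ≤ ord_T f ≤ ord_T f + δ ≤ 2·ord_T(g|_a) = 2·ord g ≤ 2(d − ρ)`
(`stub_halfTwoMax`, landed; `stub_lineData`, `stub_genericLine`, landed). So the factor `2` of the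
two-max inequality is EXACTLY what separates the line's theorem-level content (`rank ≤ 2d − ρ` from
CERT + K3) from the crux (`rank ≤ d`). [folklore] -/
theorem mordellWeilRank_le_two_mul_of_leadingFormCertificate
    (h3 : ∀ (F : Type) [Field F] [NumberField F] [IsTotallyReal F]
      (K : Type) [Field K] [NumberField K] [Algebra F K]
      (V : WeierstrassCurve F) [V.IsElliptic] (p : ℕ) [Fact p.Prime] (n : ℕ)
      (Φ : Fin n → (absoluteGaloisGroup K →ₜ* Multiplicative ℤ_[p])),
      Admissible F K p V → IsMaximalAnticyclotomicTower F K p Φ →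
        Nonempty (BoundingClass F K p V Φ))
    (F : Type) [Field F] [NumberField F] [IsTotallyReal F] (V : WeierstrassCurve F) [V.IsElliptic]
    (hcert : LeadingFormCertificate F V) :
    V.mordellWeilRank ≤ 2 * Module.finrank ℚ F := by
  obtain ⟨K, _, _, _, p, _, n, Φ, hadm, hmax, hn, hmin⟩ := hcert
  -- a bounding class of minimal total order exists (construction stub + well-ordering of ℕ)
  have hex : ∃ m : ℕ, ∃ Δ : BoundingClass F K p V Φ, MvPowerSeries.order Δ.g = m := by
    obtain ⟨Δ₀⟩ := h3 F K V p n Φ hadm hmax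
    exact ⟨(MvPowerSeries.order Δ₀.g).toNat, Δ₀,
      ((MvPowerSeries.ne_zero_iff_order_finite).mp Δ₀.g_ne_zero).symm⟩
  obtain ⟨Δ, hΔ⟩ := Nat.find_spec hex
  have hΔmin : ∀ Δ' : BoundingClass F K p V Φ,
      MvPowerSeries.order Δ.g ≤ MvPowerSeries.order Δ'.g := by
    intro Δ'
    have h' : MvPowerSeries.order Δ'.g = ((MvPowerSeries.order Δ'.g).toNat : ℕ∞) :=
      ((MvPowerSeries.ne_zero_iff_order_finite).mp Δ'.g_ne_zero).symm
    have hle : Nat.find hex ≤ (MvPowerSeries.order Δ'.g).toNat := Nat.find_min' hex ⟨Δ', h'⟩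
    rw [hΔ, h']
    exact_mod_cast hle
  obtain ⟨hρd, hordg⟩ := hmin Δ hΔmin
  obtain ⟨a, hunit, hha, horda⟩ := stub_genericLine p n Δ.g Δ.h Δ.g_ne_zero Δ.h_ne_zero
  have horda' : PowerSeries.order (lineRestrict a Δ.g) = MvPowerSeries.order Δ.g := by
    rw [lineRestrict_eq]; exact horda
  obtain ⟨κ, hline, γ, hγ, hD⟩ := stub_lineData K p n Φ a hmax.2.1 ⟨⟨0, hn⟩, hunit ⟨0, hn⟩⟩
  have hline' : IsLineOf Φ a κ := (isLineOf_iff Φ a κ).2 hline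
  haveI : (V.baseChange K).IsElliptic := inferInstanceAs (V.map (algebraMap F K)).IsElliptic
  obtain ⟨D, hfin⟩ := hD (V.baseChange K)
  haveI := hfin
  obtain ⟨hrank, f, hf, hf0, hfle⟩ := Δ.bound a κ γ D hline' hha hγ
  -- the HALF two-max inequality along the line (landed stub K2½): no anticyclotomic input at all
  have h2' := stub_halfTwoMax F K V p κ γ D hγ f hf
  rw [hrank] at h2'
  have hg : MvPowerSeries.order Δ.g = ((MvPowerSeries.order Δ.g).toNat : ℕ∞) :=
    ((MvPowerSeries.ne_zero_iff_order_finite).mp Δ.g_ne_zero).symm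
  set m := (MvPowerSeries.order Δ.g).toNat with hm_def
  have hm : m ≤ Module.finrank ℚ F - Δ.rho := by
    rw [hg] at hordg
    exact_mod_cast hordg
  have hchain :
      ((max V.mordellWeilRank ((V.baseChange K).mordellWeilRank - V.mordellWeilRank) -
          Δ.rho : ℕ) : ℕ∞) ≤ ((2 * m : ℕ) : ℕ∞) :=
    calc ((max V.mordellWeilRank ((V.baseChange K).mordellWeilRank - V.mordellWeilRank) -
            Δ.rho : ℕ) : ℕ∞)
          ≤ PowerSeries.order f := h2'
      _ ≤ PowerSeries.order f + (trivialZeroCount F K p V : ℕ∞) := le_self_add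
      _ ≤ 2 * PowerSeries.order (lineRestrict a Δ.g) := hfle
      _ = 2 * MvPowerSeries.order Δ.g := by rw [horda']
      _ = ((2 * m : ℕ) : ℕ∞) := by rw [hg]; push_cast; rfl
  have hchain' :
      max V.mordellWeilRank ((V.baseChange K).mordellWeilRank - V.mordellWeilRank) - Δ.rho ≤
        2 * m := by
    exact_mod_cast hchain
  have hM : max V.mordellWeilRank ((V.baseChange K).mordellWeilRank - V.mordellWeilRank) ≤
      2 * Module.finrank ℚ F - Δ.rho := by
    omega
  exact le_trans (le_max_left _ _) (hM.trans (Nat.sub_le _ _))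

/-! ### Disproof used: the certificate is false without the analytic hypothesis -/

/-- CERT with `V.analyticRank = [F:ℚ]` DROPPED. [folklore] -/
def LeadingFormCertificateWithoutAnalyticRank : Prop :=
  ∀ (F : Type) [Field F] [NumberField F] [IsTotallyReal F] (V : WeierstrassCurve F) [V.IsElliptic],
    2 ≤ Module.finrank ℚ F → LeadingFormCertificate F V

/-- **`V.analyticRank = [F:ℚ]` is load-bearing exactly at `stub_leadingFormCertificate`**: given the
two XL theorem-shaped stubs (and the two landed ones), the `r_an`-free certificate implies the
`r_an`-free crux, which the landed negative lemma `plecticRankUB_false_without_analyticRank`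
(p146677; `E₁₂₅₄ ⊗ ℚ(√5)`, rank `≥ 3 > 2`) refutes — the Disproof's §1 obstruction, honoured by this
line's stub set. [folklore] -/
theorem leadingFormCertificate_false_without_analyticRank
    (h2 : ∀ (F : Type) [Field F] [NumberField F] [IsTotallyReal F]
      (K : Type) [Field K] [NumberField K] [Algebra F K] [IsTotallyComplex K]
      (V : WeierstrassCurve F) [V.IsElliptic] (p : ℕ) [Fact p.Prime]
      (κ : ZpExtension K p) (γ : absoluteGaloisGroup K)
      (D : (V.baseChange K).SelmerDualData κ γ) [Module.Finite (IwasawaAlgebra p) D.X],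
      Module.finrank F K = 2 → 5 ≤ p → IsAnticyclotomicOver F K p κ → κ.IsTopGenerator γ →
      NoPTorsionInPExtensions F K p V → SemistableOrdinaryAbove F K p V → UnramifiedAbove F K p →
      ∀ f ∈ Literature.NumberTheory.EllipticCurves.Module.charIdeal (IwasawaAlgebra p)
          ↥(Submodule.torsion (IwasawaAlgebra p) D.X), f ≠ 0 →
        ((2 * (max V.mordellWeilRank ((V.baseChange K).mordellWeilRank - V.mordellWeilRank) -
            Module.finrank (IwasawaAlgebra p) D.X) : ℕ) : ℕ∞) ≤
          PowerSeries.order f + (trivialZeroCount F K p V : ℕ∞))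
    (h3 : ∀ (F : Type) [Field F] [NumberField F] [IsTotallyReal F]
      (K : Type) [Field K] [NumberField K] [Algebra F K]
      (V : WeierstrassCurve F) [V.IsElliptic] (p : ℕ) [Fact p.Prime] (n : ℕ)
      (Φ : Fin n → (absoluteGaloisGroup K →ₜ* Multiplicative ℤ_[p])),
      Admissible F K p V → IsMaximalAnticyclotomicTower F K p Φ →
        Nonempty (BoundingClass F K p V Φ)) :
    ¬ LeadingFormCertificateWithoutAnalyticRank := fun hc =>
  Summit.BirchSwinnertonDyer.BirchSwinnertonDyer.Theorems.plecticRankUB_false_without_analyticRank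
    fun F _ _ _ V _ hd => mordellWeilRank_le_of_leadingFormCertificate h2 h3 F V (hc F V hd)

/-- **`V.analyticRank = [F:ℚ]` is load-bearing for the HALF line too: without it, CERT is false
given ONLY the construction stub K3** (no two-max inequality): by
`mordellWeilRank_le_two_mul_of_leadingFormCertificate` the `r_an`-free certificate and K3 give
`rank V(F) ≤ 2[F:ℚ]` for every `V` over every totally real `F` of degree `≥ 2`, refuted by
`W₅ ⊗ ℚ(√5)` with `rank ≥ rank W₅(ℚ) ≥ 5 > 4` (`exists_five_le_mordellWeilRank`, monotonicity of
the rank under base change). So even the theorem-level content of the line (`rank ≤ 2d − ρ`)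
consumes the analytic rank through CERT. [folklore] -/
theorem leadingFormCertificate_false_without_analyticRank_of_boundingClass
    (h3 : ∀ (F : Type) [Field F] [NumberField F] [IsTotallyReal F]
      (K : Type) [Field K] [NumberField K] [Algebra F K]
      (V : WeierstrassCurve F) [V.IsElliptic] (p : ℕ) [Fact p.Prime] (n : ℕ)
      (Φ : Fin n → (absoluteGaloisGroup K →ₜ* Multiplicative ℤ_[p])),
      Admissible F K p V → IsMaximalAnticyclotomicTower F K p Φ →
        Nonempty (BoundingClass F K p V Φ)) :
    ¬ LeadingFormCertificateWithoutAnalyticRank := by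
  intro hc
  -- the real quadratic field of discriminant 5
  obtain ⟨K, _, _, h2, hdK⟩ :=
    Literature.NumberTheory.QuadraticFields.Quadratic.exists_numberField_discr_eq (D := 5)
      (Or.inl ⟨by norm_num, by rw [← Int.squarefree_natAbs]; exact Nat.prime_five.squarefree,
        by norm_num⟩)
  haveI : IsTotallyReal K := by
    rw [← NumberField.nrComplexPlaces_eq_zero_iff]
    have hsign := NumberField.sign_discr K
    rw [hdK] at hsign
    have heven : Even (NumberField.InfinitePlace.nrComplexPlaces K) := by
      by_contra hodd
      rw [Nat.not_even_iff_odd] at hodd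
      rw [hodd.neg_one_pow] at hsign
      norm_num at hsign
    have hrk := NumberField.InfinitePlace.card_add_two_mul_card_eq_rank K
    rw [h2] at hrk
    obtain ⟨m, hm⟩ := heven
    omega
  obtain ⟨W, hW, h5⟩ := exists_five_le_mordellWeilRank
  haveI : (W.baseChange K).IsElliptic := inferInstanceAs (W.map (algebraMap ℚ K)).IsElliptic
  have hle := mordellWeilRank_le_two_mul_of_leadingFormCertificate h3 K (W.baseChange K)
    (hc K (W.baseChange K) (by omega))
  have hmono :=
    _root_.Summit.BirchSwinnertonDyer.BirchSwinnertonDyer.Theorems.mordellWeilRank_le_mordellWeilRank_baseChange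
      W K
  omega

/-! ### The interface is engine-free (K3 audit, kernel-checked) -/

section EngineFree

variable (F : Type) [Field F] [NumberField F] (K : Type) [Field K] [NumberField K] [Algebra F K]
  (p : ℕ) [Fact p.Prime] (V : WeierstrassCurve F)

/-- **The generic bound** — the engine-free content of `stub_boundingClass_exists`: there are a
nonzero polynomial `h` (exceptional directions) and constants `rho E : ℕ` such that along every line
`κ` of `Φ` of integral direction `a` with `h(a) ≠ 0`, for every topological generator `γ` and every
finitely generated dual datum `D`: `rank_Λ D.X = rho` and `char_Λ (D.X)_tors ∋ f ≠ 0` with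
`ord_T f + δ ≤ E`. No class `g`, no Heegner point, no `L`-function. [folklore] -/
def GenericBound {n : ℕ} (Φ : Fin n → (absoluteGaloisGroup K →ₜ* Multiplicative ℤ_[p])) : Prop :=
  ∃ (rho E : ℕ) (h : MvPolynomial (Fin n) ℤ_[p]), h ≠ 0 ∧
    ∀ (a : Fin n → ℕ) (κ : ZpExtension K p) (γ : absoluteGaloisGroup K)
      (D : (V.baseChange K).SelmerDualData κ γ) [Module.Finite (IwasawaAlgebra p) D.X],
      IsLineOf Φ a κ → MvPolynomial.eval (fun i => (a i : ℤ_[p])) h ≠ 0 → κ.IsTopGenerator γ →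
        Module.finrank (IwasawaAlgebra p) D.X = rho ∧
          ∃ f ∈ Literature.NumberTheory.EllipticCurves.Module.charIdeal (IwasawaAlgebra p)
              ↥(Submodule.torsion (IwasawaAlgebra p) D.X),
            f ≠ 0 ∧ PowerSeries.order f + (trivialZeroCount F K p V : ℕ∞) ≤ (E : ℕ∞)

variable {K p}

omit [NumberField K] in
/-- No `ℤ_p`-extension is a line of the EMPTY tower (`n = 0`): the line condition forces `κ` to be
trivial, contradicting surjectivity. So for `n = 0` the `bound` field of `BoundingClass` is vacuous.
[folklore] -/
theorem not_isLineOf_zero (Φ : Fin 0 → (absoluteGaloisGroup K →ₜ* Multiplicative ℤ_[p]))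
    (a : Fin 0 → ℕ) (κ : ZpExtension K p) : ¬ IsLineOf Φ a κ := by
  intro hline
  obtain ⟨σ, hσ⟩ := κ.surjective (Multiplicative.ofAdd 1)
  have h1 := hline σ
  simp only [Finset.univ_eq_empty, Finset.sum_empty] at h1
  have : (κ σ).toAdd = (1 : ℤ_[p]) := by
    change (κ.toContinuousMonoidHom σ).toAdd = 1
    rw [hσ]; rfl
  rw [this] at h1
  exact one_ne_zero h1

/-- Restriction of the monomial class `Xᵢ ^ E` to the line of direction `a` is
`((1+T)^{aᵢ} − 1)^E`. [folklore] -/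
theorem lineRestrict_X_pow {n : ℕ} (a : Fin n → ℕ) (i : Fin n) (E : ℕ) :
    lineRestrict a ((MvPowerSeries.X i : MvPowerSeries (Fin n) ℤ_[p]) ^ E) =
      (lineGen (p := p) (a i)) ^ E := by
  unfold lineRestrict
  rw [MvPowerSeries.subst_pow (hasSubst_lineGen a), MvPowerSeries.subst_X (hasSubst_lineGen a)]

/-- `ord_T ((1+T)^{aᵢ} − 1)^E ≥ E`, hence the restriction of `Xᵢ ^ E` to ANY line has `T`-order
`≥ E`. [folklore] -/
theorem le_order_lineRestrict_X_pow {n : ℕ} (a : Fin n → ℕ) (i : Fin n) (E : ℕ) :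
    (E : ℕ∞) ≤ PowerSeries.order
      (lineRestrict a ((MvPowerSeries.X i : MvPowerSeries (Fin n) ℤ_[p]) ^ E)) := by
  rw [lineRestrict_X_pow]
  refine PowerSeries.le_order_pow_of_constantCoeff_eq_zero E ?_
  simp [lineGen]

/-- `Xᵢ ^ E ≠ 0` in `ℤ_p⟦T₁,…,T_n⟧` (its coefficient at `Tᵢ^E` is `1`). [folklore] -/
theorem X_pow_ne_zero {n : ℕ} (i : Fin n) (E : ℕ) :
    (MvPowerSeries.X i : MvPowerSeries (Fin n) ℤ_[p]) ^ E ≠ 0 := by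
  intro h
  have := congrArg (MvPowerSeries.coeff (Finsupp.single i E)) h
  rw [MvPowerSeries.X_pow_eq, MvPowerSeries.coeff_monomial_same, map_zero] at this
  exact one_ne_zero this

/-- **The characteristic ideal over `Λ` is never `⊥`**: it is a `finprod` of powers of height-one
primes, each nonzero in a domain, and the junk value of an infinite product is `1 = ⊤`. Hence
"`∃ f ∈ char, f ≠ 0`" in `BoundingClass.bound` is free; only the ORDER bound has content.
[folklore] -/
theorem charIdeal_ne_bot (M : Type*) [AddCommGroup M] [Module (IwasawaAlgebra p) M] :
    Literature.NumberTheory.EllipticCurves.Module.charIdeal (IwasawaAlgebra p) M ≠ ⊥ := by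
  unfold Literature.NumberTheory.EllipticCurves.Module.charIdeal
  refine finprod_mem_induction (· ≠ (⊥ : Ideal (IwasawaAlgebra p))) ?_ ?_ ?_
  · rw [Ideal.one_eq_top]; exact top_ne_bot
  · intro I J hI hJ
    rw [Ne, Ideal.mul_eq_bot, not_or]
    exact ⟨hI, hJ⟩
  · intro 𝔭 h𝔭
    have hne : 𝔭.asIdeal ≠ ⊥ := by
      intro hbot
      have h1 : 𝔭.asIdeal.height = 1 := h𝔭
      rw [hbot, Ideal.height_bot] at h1
      exact zero_ne_one h1
    rw [Ne, ← Submodule.zero_eq_bot] at hne ⊢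
    exact pow_ne_zero _ hne

variable (K p)

omit [NumberField F] in
/-- **The interface is engine-free (⇐): a generic bound already yields a bounding class.** Given
`GenericBound` (constants `rho`, `E`, exceptional polynomial `h`), the data `g := X₀ ^ E` (`n ≥ 1`;
`g := 1` for `n = 0`, where no line exists), the same `h` and `rho` form a `BoundingClass`:
`ord_T f + δ ≤ E ≤ ord_T (g|_a) ≤ 2·ord_T (g|_a)` on every line. So the interface never forces `g`
to be an arithmetic object, the minimal total order of a bounding class is at most `E` for every
generic bound `E` (in fact `⌈E_gen/2⌉` with `g := X₀^{⌈E/2⌉}`), and CERT is a statement about the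
generic `T`-multiplicity `e + δ` of anticyclotomic Selmer duals: `(e + δ)_gen ≤ 2(d − ρ)` at some
admissible datum. (Conversely a bounding class gives a generic bound after enlarging `h` by the
leading form of `g`: `stub_genericLine`.) [folklore] -/
theorem boundingClass_of_genericBound {n : ℕ}
    (Φ : Fin n → (absoluteGaloisGroup K →ₜ* Multiplicative ℤ_[p]))
    (hgen : GenericBound F K p V Φ) : Nonempty (BoundingClass F K p V Φ) := by
  obtain ⟨rho, E, h, hh, hb⟩ := hgen
  cases n with
  | zero =>
    exact ⟨{ rho := rho, g := 1, g_ne_zero := one_ne_zero, h := h, h_ne_zero := hh,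
             bound := fun a κ γ D _ hline _ _ => (not_isLineOf_zero Φ a κ hline).elim }⟩
  | succ m =>
    refine ⟨{ rho := rho, g := (MvPowerSeries.X (0 : Fin (m + 1))) ^ E,
              g_ne_zero := X_pow_ne_zero 0 E, h := h, h_ne_zero := hh, bound := ?_ }⟩
    intro a κ γ D _ hline hha hγ
    obtain ⟨hrank, f, hf, hf0, hfE⟩ := hb a κ γ D hline hha hγ
    refine ⟨hrank, f, hf, hf0, hfE.trans ((le_order_lineRestrict_X_pow (p := p) a 0 E).trans ?_)⟩
    exact le_mul_of_one_le_left bot_le one_le_two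

omit [NumberField F] in
/-- **Degenerate case `n = 0` of K3, provable outright**: the empty tower has no lines, so
`Nonempty (BoundingClass …)` holds with no arithmetic (CERT excludes it by `0 < n`). [folklore] -/
theorem boundingClass_zero (Φ : Fin 0 → (absoluteGaloisGroup K →ₜ* Multiplicative ℤ_[p])) :
    Nonempty (BoundingClass F K p V Φ) :=
  boundingClass_of_genericBound F K p V Φ
    ⟨0, 0, 1, one_ne_zero, fun a κ _ _ _ hline _ _ => (not_isLineOf_zero Φ a κ hline).elim⟩

end EngineFree

/-! ### CERT unfolded: the certificate is a generic multiplicity bound (lead, cycle 1) -/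

section CertificateUnfolded

variable (F : Type) [Field F] [NumberField F] (K : Type) [Field K] [NumberField K] [Algebra F K]
  (p : ℕ) [Fact p.Prime] (V : WeierstrassCurve F)

/-- **A generic certificate of level `d` on the tower `Φ`**: a generic bound (`rho`, `E`, `h`) with
`rho ≤ d` and `E ≤ 2(d − rho)` — off the hypersurface `{h = 0}` of integral directions, every
finitely generated Selmer dual datum along a line of `Φ` has `Λ`-rank `rho ≤ d` and
`ord_T char(X_tors) + δ ≤ 2(d − rho)`. This is an `r_an`-free-LOOKING statement about anticyclotomic
Selmer duals (no class `g`, no Heegner point, no `L`-function); `certAt_iff_genericCertificate`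
shows it IS the certificate as soon as one bounding class exists. [folklore] -/
def GenericCertificate (d : ℕ) {n : ℕ}
    (Φ : Fin n → (absoluteGaloisGroup K →ₜ* Multiplicative ℤ_[p])) : Prop :=
  ∃ (rho E : ℕ) (h : MvPolynomial (Fin n) ℤ_[p]), h ≠ 0 ∧ rho ≤ d ∧ E ≤ 2 * (d - rho) ∧
    ∀ (a : Fin n → ℕ) (κ : ZpExtension K p) (γ : absoluteGaloisGroup K)
      (D : (V.baseChange K).SelmerDualData κ γ) [Module.Finite (IwasawaAlgebra p) D.X],
      IsLineOf Φ a κ → MvPolynomial.eval (fun i => (a i : ℤ_[p])) h ≠ 0 → κ.IsTopGenerator γ →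
        Module.finrank (IwasawaAlgebra p) D.X = rho ∧
          ∃ f ∈ Literature.NumberTheory.EllipticCurves.Module.charIdeal (IwasawaAlgebra p)
              ↥(Submodule.torsion (IwasawaAlgebra p) D.X),
            f ≠ 0 ∧ PowerSeries.order f + (trivialZeroCount F K p V : ℕ∞) ≤ (E : ℕ∞)

/-- **CERT at one tower** (the matrix of `LeadingFormCertificate` with `(K, p, Φ)` fixed and the
level `d` a parameter): every bounding class of minimal total order has `rho ≤ d` and total order
`≤ d − rho`. [folklore] -/
def CertAt (d : ℕ) {n : ℕ} (Φ : Fin n → (absoluteGaloisGroup K →ₜ* Multiplicative ℤ_[p])) :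
    Prop :=
  ∀ Δ : BoundingClass F K p V Φ,
    (∀ Δ' : BoundingClass F K p V Φ, MvPowerSeries.order Δ.g ≤ MvPowerSeries.order Δ'.g) →
      Δ.rho ≤ d ∧ MvPowerSeries.order Δ.g ≤ ((d - Δ.rho : ℕ) : ℕ∞)

/-- `LeadingFormCertificate` is `CertAt (finrank ℚ F)` at some admissible datum with a maximal
tower of positive rank (definitional unfolding). [folklore] -/
theorem leadingFormCertificate_iff_exists_certAt :
    LeadingFormCertificate F V ↔
      ∃ (K : Type) (_ : Field K) (_ : NumberField K) (_ : Algebra F K) (p : ℕ) (_ : Fact p.Prime)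
        (n : ℕ) (Φ : Fin n → (absoluteGaloisGroup K →ₜ* Multiplicative ℤ_[p])),
        Admissible F K p V ∧ IsMaximalAnticyclotomicTower F K p Φ ∧ 0 < n ∧
          CertAt F K p V (Module.finrank ℚ F) Φ :=
  Iff.rfl

variable {F K p V}

omit [NumberField F] in
/-- **The `Λ`-rank of a bounding class is intrinsic.** Two bounding classes on a tower of positive
rank whose characters are jointly surjective have the same `rho`: a common non-exceptional integral
line exists (`stub_genericLine` applied to `g = 1`, `h = h₁h₂`), it is a `ℤ_p`-extension carrying a
finitely generated Selmer dual datum (`stub_lineData`), and both `bound`s compute its `Λ`-rank.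
[folklore] -/
theorem BoundingClass.rho_eq [V.IsElliptic] {n : ℕ}
    {Φ : Fin n → (absoluteGaloisGroup K →ₜ* Multiplicative ℤ_[p])}
    (hsurj : Function.Surjective (fun (σ : absoluteGaloisGroup K) (i : Fin n) => (Φ i σ).toAdd))
    (hn : 0 < n) (Δ₁ Δ₂ : BoundingClass F K p V Φ) : Δ₁.rho = Δ₂.rho := by
  have hH : Δ₁.h * Δ₂.h ≠ 0 := mul_ne_zero Δ₁.h_ne_zero Δ₂.h_ne_zero
  obtain ⟨a, hunit, hha, -⟩ := stub_genericLine p n 1 (Δ₁.h * Δ₂.h) one_ne_zero hH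
  rw [map_mul] at hha
  obtain ⟨κ, hline, γ, hγ, hD⟩ := stub_lineData K p n Φ a hsurj ⟨⟨0, hn⟩, hunit ⟨0, hn⟩⟩
  have hline' : IsLineOf Φ a κ := (isLineOf_iff Φ a κ).2 hline
  haveI : (V.baseChange K).IsElliptic := inferInstanceAs (V.map (algebraMap F K)).IsElliptic
  obtain ⟨D, hfin⟩ := hD (V.baseChange K)
  haveI := hfin
  obtain ⟨h1, -⟩ := Δ₁.bound a κ γ D hline' (mul_ne_zero_iff.mp hha).1 hγ
  obtain ⟨h2, -⟩ := Δ₂.bound a κ γ D hline' (mul_ne_zero_iff.mp hha).2 hγ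
  rw [← h1, ← h2]

omit [NumberField F] in
/-- **A bounding class yields a generic bound of level `2·ord g` (⇒ of engine-freeness).** Off the
hypersurface `{h · g_ν = 0}` (`g_ν` the leading form of `g`, `ν = ord g`), the restriction of `g`
to the line has `T`-order exactly `ν` (`order_lineSubst_eq_of_eval_leadingForm_ne_zero`, the
pointwise form of `stub_genericLine`), so the interface bound reads `ord_T f + δ ≤ 2ν`. [folklore] -/
theorem BoundingClass.genericBound {n : ℕ}
    {Φ : Fin n → (absoluteGaloisGroup K →ₜ* Multiplicative ℤ_[p])} (Δ : BoundingClass F K p V Φ) :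
    ∃ (N : ℕ) (h' : MvPolynomial (Fin n) ℤ_[p]), h' ≠ 0 ∧ MvPowerSeries.order Δ.g = N ∧
      ∀ (a : Fin n → ℕ) (κ : ZpExtension K p) (γ : absoluteGaloisGroup K)
        (D : (V.baseChange K).SelmerDualData κ γ) [Module.Finite (IwasawaAlgebra p) D.X],
        IsLineOf Φ a κ → MvPolynomial.eval (fun i => (a i : ℤ_[p])) h' ≠ 0 → κ.IsTopGenerator γ →
          Module.finrank (IwasawaAlgebra p) D.X = Δ.rho ∧
            ∃ f ∈ Literature.NumberTheory.EllipticCurves.Module.charIdeal (IwasawaAlgebra p)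
                ↥(Submodule.torsion (IwasawaAlgebra p) D.X),
              f ≠ 0 ∧ PowerSeries.order f + (trivialZeroCount F K p V : ℕ∞) ≤ ((2 * N : ℕ) : ℕ∞) := by
  -- the total order `N` of `g` and its leading form `gN ≠ 0`
  obtain ⟨N, hN⟩ : ∃ N : ℕ, (N : ℕ∞) = MvPowerSeries.order Δ.g :=
    ENat.ne_top_iff_exists.mp (mt MvPowerSeries.order_eq_top_iff.mp Δ.g_ne_zero)
  set gN : MvPolynomial (Fin n) ℤ_[p] :=
    MvPowerSeries.truncFinset ℤ_[p] ((Finset.univ : Finset (Fin n)).finsuppAntidiag N) Δ.g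
    with hgN_eq
  have hgN : gN ≠ 0 := by
    obtain ⟨⟨d, hd, hdN⟩, -⟩ := MvPowerSeries.order_eq_nat.mp hN.symm
    have hmem : d ∈ (Finset.univ : Finset (Fin n)).finsuppAntidiag N := by
      rw [Finset.mem_finsuppAntidiag, ← Finsupp.degree_eq_sum]
      exact ⟨by exact_mod_cast hdN, Finset.subset_univ _⟩
    intro h0
    apply hd
    rw [← MvPowerSeries.coeff_truncFinset_of_mem Δ.g hmem, ← hgN_eq, h0, MvPolynomial.coeff_zero]
  refine ⟨N, Δ.h * gN, mul_ne_zero Δ.h_ne_zero hgN, hN.symm, ?_⟩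
  intro a κ γ D _ hline hha hγ
  rw [map_mul] at hha
  obtain ⟨hrank, f, hf, hf0, hfle⟩ := Δ.bound a κ γ D hline (mul_ne_zero_iff.mp hha).1 hγ
  have horder : PowerSeries.order (lineRestrict a Δ.g) = N := by
    rw [lineRestrict_eq]
    exact order_lineSubst_eq_of_eval_leadingForm_ne_zero ℤ_[p] n Δ.g a N hN.symm
      (mul_ne_zero_iff.mp hha).2
  refine ⟨hrank, f, hf, hf0, hfle.trans ?_⟩
  rw [horder]
  push_cast
  exact le_rfl

omit [NumberField F] in
/-- **The interface is engine-free (⇐, graded form): a generic bound of level `E ≤ 2m` yields a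
bounding class of total order exactly `m`** (`n ≥ 1`; `g := X₀^m`). [folklore] -/
theorem boundingClass_of_bound_le {n : ℕ}
    (Φ : Fin (n + 1) → (absoluteGaloisGroup K →ₜ* Multiplicative ℤ_[p])) (rho E m : ℕ)
    (hEm : E ≤ 2 * m) (h : MvPolynomial (Fin (n + 1)) ℤ_[p]) (hh : h ≠ 0)
    (hb : ∀ (a : Fin (n + 1) → ℕ) (κ : ZpExtension K p) (γ : absoluteGaloisGroup K)
      (D : (V.baseChange K).SelmerDualData κ γ) [Module.Finite (IwasawaAlgebra p) D.X],
      IsLineOf Φ a κ → MvPolynomial.eval (fun i => (a i : ℤ_[p])) h ≠ 0 → κ.IsTopGenerator γ →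
        Module.finrank (IwasawaAlgebra p) D.X = rho ∧
          ∃ f ∈ Literature.NumberTheory.EllipticCurves.Module.charIdeal (IwasawaAlgebra p)
              ↥(Submodule.torsion (IwasawaAlgebra p) D.X),
            f ≠ 0 ∧ PowerSeries.order f + (trivialZeroCount F K p V : ℕ∞) ≤ (E : ℕ∞)) :
    ∃ Δ : BoundingClass F K p V Φ, Δ.rho = rho ∧ MvPowerSeries.order Δ.g = m := by
  refine ⟨{ rho := rho, g := (MvPowerSeries.X (0 : Fin (n + 1))) ^ m,
            g_ne_zero := X_pow_ne_zero 0 m, h := h, h_ne_zero := hh, bound := ?_ }, rfl, ?_⟩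
  · intro a κ γ D _ hline hha hγ
    obtain ⟨hrank, f, hf, hf0, hfE⟩ := hb a κ γ D hline hha hγ
    refine ⟨hrank, f, hf, hf0, hfE.trans ?_⟩
    calc ((E : ℕ) : ℕ∞) ≤ ((2 * m : ℕ) : ℕ∞) := by exact_mod_cast hEm
      _ = 2 * (m : ℕ∞) := by push_cast; rfl
      _ ≤ 2 * PowerSeries.order (lineRestrict a ((MvPowerSeries.X (0 : Fin (n + 1))) ^ m)) := by
          gcongr
          exact le_order_lineRestrict_X_pow (p := p) a 0 m
  · change MvPowerSeries.order ((MvPowerSeries.X (0 : Fin (n + 1)) : MvPowerSeries _ ℤ_[p]) ^ m) = m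
    rw [MvPowerSeries.X_pow_eq, MvPowerSeries.order_monomial_of_ne_zero one_ne_zero,
      Finsupp.degree_single]

omit [NumberField F] in
/-- **CERT unfolded.** On a tower of positive rank with jointly surjective characters (e.g. a
maximal anticyclotomic tower, `IsMaximalAnticyclotomicTower.2.1`) that carries at least one
bounding class (the output of `stub_boundingClass_exists`), the certificate of level `d` holds iff a
GENERIC CERTIFICATE of level `d` does: `∃ (rho ≤ d) (E ≤ 2(d − rho))` such that, off a hypersurface
of directions, rank_Λ X(V/K_a) = rho and `ord_T char X(V/K_a)_tors + δ ≤ E`. So the content of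
`stub_leadingFormCertificate` is: "at some admissible `(K, p)`, GENERICALLY along the anticyclotomic
`ℤ_p`-lines of `K`, the `T`-multiplicity of the (extended) Selmer dual is `≤ 2(d − ρ)`" — by
`stub_twoMaxInequality` at least `2(max(r⁺,r⁻) − ρ)`, so on a curve of rank `d` exactly
`2(d − ρ)`: main-conjecture order `= 2·(rank − ρ)`, i.e. `Ш[p^∞]`-finiteness-plus-height-
non-degeneracy in Iwasawa costume (`PAdicHeightNondegeneracy` bites everywhere in the typing; the
plectic engine can only enter a PROOF, as the `g` of a bounding class). [folklore] -/
theorem certAt_iff_genericCertificate [V.IsElliptic] {n : ℕ}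
    {Φ : Fin n → (absoluteGaloisGroup K →ₜ* Multiplicative ℤ_[p])}
    (hsurj : Function.Surjective (fun (σ : absoluteGaloisGroup K) (i : Fin n) => (Φ i σ).toAdd))
    (hn : 0 < n) (hne : Nonempty (BoundingClass F K p V Φ)) (d : ℕ) :
    CertAt F K p V d Φ ↔ GenericCertificate F K p V d Φ := by
  constructor
  · intro hcert
    -- a bounding class of minimal total order
    have hex : ∃ m : ℕ, ∃ Δ : BoundingClass F K p V Φ, MvPowerSeries.order Δ.g = m := by
      obtain ⟨Δ₀⟩ := hne
      exact ⟨(MvPowerSeries.order Δ₀.g).toNat, Δ₀,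
        ((MvPowerSeries.ne_zero_iff_order_finite).mp Δ₀.g_ne_zero).symm⟩
    obtain ⟨Δ, hΔ⟩ := Nat.find_spec hex
    have hΔmin : ∀ Δ' : BoundingClass F K p V Φ,
        MvPowerSeries.order Δ.g ≤ MvPowerSeries.order Δ'.g := by
      intro Δ'
      have h' : MvPowerSeries.order Δ'.g = ((MvPowerSeries.order Δ'.g).toNat : ℕ∞) :=
        ((MvPowerSeries.ne_zero_iff_order_finite).mp Δ'.g_ne_zero).symm
      have hle : Nat.find hex ≤ (MvPowerSeries.order Δ'.g).toNat := Nat.find_min' hex ⟨Δ', h'⟩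
      rw [hΔ, h']
      exact_mod_cast hle
    obtain ⟨hρd, hordg⟩ := hcert Δ hΔmin
    obtain ⟨N, h', hh', hN, hb⟩ := Δ.genericBound
    have hNd : N ≤ d - Δ.rho := by
      rw [hN] at hordg
      exact_mod_cast hordg
    exact ⟨Δ.rho, 2 * N, h', hh', hρd, by omega, hb⟩
  · rintro ⟨rho, E, h, hh, hρd, hE, hb⟩ Δ hΔmin
    obtain ⟨m, rfl⟩ : ∃ m, n = m + 1 := ⟨n - 1, by omega⟩
    obtain ⟨Δ₀, hρ₀, hord₀⟩ := boundingClass_of_bound_le Φ rho E (d - rho) hE h hh hb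
    have hρ : Δ.rho = rho := (BoundingClass.rho_eq hsurj hn Δ Δ₀).trans hρ₀
    refine ⟨hρ ▸ hρd, ?_⟩
    rw [hρ, ← hord₀]
    exact hΔmin Δ₀

/-- **Corollary: with the construction stub, the certificate IS the generic certificate.** Given
`stub_boundingClass_exists` (as a hypothesis, it is an open XL stub), `LeadingFormCertificate F V`
holds iff some admissible datum with a maximal tower of positive rank carries a generic certificate
of level `[F:ℚ]`. [folklore] -/
theorem leadingFormCertificate_iff_genericCertificate [V.IsElliptic]
    (h3 : ∀ (F : Type) [Field F] [NumberField F] [IsTotallyReal F]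
      (K : Type) [Field K] [NumberField K] [Algebra F K]
      (V : WeierstrassCurve F) [V.IsElliptic] (p : ℕ) [Fact p.Prime] (n : ℕ)
      (Φ : Fin n → (absoluteGaloisGroup K →ₜ* Multiplicative ℤ_[p])),
      Admissible F K p V → IsMaximalAnticyclotomicTower F K p Φ →
        Nonempty (BoundingClass F K p V Φ)) [IsTotallyReal F] :
    LeadingFormCertificate F V ↔
      ∃ (K : Type) (_ : Field K) (_ : NumberField K) (_ : Algebra F K) (p : ℕ) (_ : Fact p.Prime)
        (n : ℕ) (Φ : Fin n → (absoluteGaloisGroup K →ₜ* Multiplicative ℤ_[p])),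
        Admissible F K p V ∧ IsMaximalAnticyclotomicTower F K p Φ ∧ 0 < n ∧
          GenericCertificate F K p V (Module.finrank ℚ F) Φ := by
  constructor
  · rintro ⟨K, _, _, _, p, _, n, Φ, hadm, hmax, hn, hcert⟩
    exact ⟨K, _, _, _, p, _, n, Φ, hadm, hmax, hn,
      (certAt_iff_genericCertificate hmax.2.1 hn (h3 F K V p n Φ hadm hmax) _).1 hcert⟩
  · rintro ⟨K, _, _, _, p, _, n, Φ, hadm, hmax, hn, hgen⟩
    exact ⟨K, _, _, _, p, _, n, Φ, hadm, hmax, hn,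
      (certAt_iff_genericCertificate hmax.2.1 hn (h3 F K V p n Φ hadm hmax) _).2 hgen⟩

end CertificateUnfolded

end Summit.BirchSwinnertonDyer.BirchSwinnertonDyer.Cruxes.PlecticRankUB.HeegnerLeadingFormPlecticCertificate

end
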